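import Literature.Barriers.RiemannHypothesis.MertensDisproof
import Literature.NumberTheory.LFunctions.ZetaZeroLinearRelations
import Literature.NumberTheory.LFunctions.MertensConjectureOneSidedZeros
import Literature.NumberTheory.LFunctions.ZetaZerosProofs
import HarnessLib

/-!
# Best–Trudgian 2015: the architecture of `limsup M(x)x^{-1/2} ≥ 1.6383` (Thm. 1) — Ingham's alternative (2.7) proved, Theorem 2 as a named fact (discharged in `BestTrudgian2015Proofs.lean`), Theorem 1 reduced to the certificate of Theorem 4

Barrier catalogue `Literature/Barriers/RiemannHypothesis/` (D-0021), support file for the entry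
`MertensDisproof` (`MertensDisproof.lean`), whose named fact

> `Literature.Barriers.RiemannHypothesis.BestTrudgian2015_thm1` — "`limsup_{x→∞} M(x)x^{−1/2} ≥ 1.6383`,
> `liminf_{x→∞} M(x)x^{−1/2} ≤ −1.6383`" [BestTrudgian2015, Theorem 1]

is here reduced to the inputs of its printed proof, following

* D. G. Best, T. S. Trudgian, *Linear relations of zeroes of the zeta-function*, Math. Comp. 84
  (2015), 2047–2058; arXiv:1209.3843 [BestTrudgian2015], §2 (Outline, Theorem 2, §2.1) and §3
  (Theorem 4, §3.2, §3.4).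

## The printed proof of Theorem 1 and what this file makes of it

1. **(2.7), Ingham 1942** (§2.1): "`liminf M(x)/√x = −∞`, `limsup M(x)/√x = +∞` follows if either
   the Riemann hypothesis is false or not all the zeroes are simple. Henceforth we assume the
   Riemann hypothesis and the simplicity of the zeroes." — **PROVED**
   (`frequently_gt_and_lt_of_not_riemannHypothesis_or_not_simple`) from the tree's one-sided
   Landau argument `Literature.NumberTheory.LFunctions.zetaZeros_simple_onLine_of_oneSided`
   (`MertensConjectureOneSidedZeros.lean`: a bound `ηM(x) ≤ A√x`, `x ≥ x₁`, puts every zero of the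
   critical strip on the line and makes it simple) and
   `Literature.NumberTheory.LFunctions.mem_riemannZetaNontrivialZeros_iff_holds` (non-trivial zeros lie in the open strip).
2. **Theorem 2 (Anderson–Stark) applied to `g = M`** (§2.1: `σ₀ = ½`, `r₀ = 0`,
   `r_γ = (ρζ'(ρ))⁻¹`, `ρ = ½ + iγ`; (2.8)–(2.9)) **with the kernel `f₀` of §3.2** (the
   Jurkat–Peyerimhoff weight `(1 − |t|/T)cos(πt/T) + π⁻¹ sin(π|t|/T)` "which is used by Odlyzko and
   te Riele", the tree's `Literature.NumberTheory.LFunctions.jurkatPeyerimhoffKernel (t/T)`, in place of Fejér's `1 − |t|/T`):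
   under RH and simplicity, if `Γ' ⊂ Γ ∩ (0, T)` is `{N_γ}`-independent in `Γ ∩ [0, T]`
   (`Literature.NumberTheory.LFunctions.BestTrudgian.NIndependent`, Definition 1) then
   `limsup M(x)x^{-1/2} ≥ Σ_{γ ∈ Γ'} (2N_γ/(N_γ+1)) f₀(γ)/|ρζ'(ρ)|` and `liminf ≤ −` the same sum —
   **NAMED FACT** `BestTrudgian2015_thm2M`, stated here and DISCHARGED in
   `BestTrudgian2015Proofs.lean` (`BestTrudgian2015_thm2M_holds`: the tree's Ingham smoothing
   engine `InghamSmoothing.lean` with the Anderson–Stark averaging step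
   `InghamSmoothingAveraging.lean`, the Fejér-product weight `FejerProductMeans.lean` and the
   frequency matching from Definition 1, `BestTrudgian2015Matching.lean`).
3. **Theorem 4** (§3.4: `k = 9000` digits, `n = 500`, `T ≈ γ₂₀₀₁ − ε`, LLL with `δ = ¾` on `L₀`
   and `δ = 3/10` on the `L_t`; candidate `794948` from step 6, minimum `4976` over the remaining
   `1500` zeros): "Let `Γ'` be the heaviest 500 zeroes with `T = γ₂₀₀₁ − ε`. Then the elements of
   `Γ'` are `{N_γ}`-independent, where all `N_γ`s are `4976`", together with the evaluation of the
   sum in (2.9) for this `Γ'`, which is how the constant of Theorem 1 arises — **NOT a named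
   fact: explicit hypotheses** (a height `T > 0` not an ordinate, a finite `Γ' ⊂ Γ ∩ (0, T)`, an
   integer `N ≥ 1`, `{N}`-independence of `Γ'` in `Γ ∩ [0, T]`, and the sum bound `≥ 1.6383`) of
   the reduction `BestTrudgian2015_thm1_of_nIndependent` below and of
   `BestTrudgian2015_thm1_of_certificate` (`BestTrudgian2015Proofs.lean`). This is a certified
   multiprecision lattice computation that the tree cannot reproduce: by the counting heuristic
   `(2N+1)^n ≈ 10^{2000}`, `{N}`-independence of `n = 500` reals with `|c| ≤ N` is invisible much
   below `2000` digits of the `γ`'s, far beyond the `2⁻²⁴⁰`-brackets of the tree's certified zeros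
   (`MertensCertificate.lean`); its only use in the source is as the input of Theorem 1, whose
   named fact `BestTrudgian2015_thm1` therefore remains the ONE declaration carrying this
   computational debt (D-0026: a separate `Prop` for Theorem 4 could never be discharged here
   and would count the same computation twice). Its *mathematical* content — Theorem 3 with
   Lemmas 1–3: Gram–Schmidt bounds for some basis of each lattice `L(K; ·)` certify
   `{N_γ}`-independence — is proved in `ZetaZeroLinearRelations(Certificate).lean`
   (`Literature.NumberTheory.LFunctions.BestTrudgian.nIndependent_of_gramSchmidt_bounds`), so a
   certificate `(T, Γ', N)` produced by any means feeds `BestTrudgian2015_thm1_of_certificate`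
   directly.
4. **Assembly** (`BestTrudgian2015_thm1_of_nIndependent`): if RH or simplicity fails, (1) gives
   both conclusions outright; otherwise (2) at certificate data as in (3) gives
   `limsup ≥ S ≥ 1.6383` and `liminf ≤ −S ≤ −1.6383`; with (2) discharged,
   `BestTrudgian2015Proofs.lean` records the unconditional reduction
   `BestTrudgian2015_thm1_of_certificate`. Also `odlyzko_te_riele_limsup_of_BestTrudgian`:
   Theorem 1 sharpens the tree's `rh.S22` statement `limsup > 1.06`.

## Design notes

* `Γ` of Definition 1 is the set `zetaPositiveOrdinates` of `MertensDisproof.lean` (positive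
  ordinates of zeros of `ζ`, each value once; under RH these are the `γ` with `ζ(½ + iγ) = 0`).
  Best–Trudgian take `T = γ_{L+1} − ε`, so `T` is not an ordinate and `Γ ∩ [0, T] = {γ₁, …, γ_L}`;
  we keep "`T ∉ Γ`" as a hypothesis of the fact (weaker than dropping it) and let `Γ'` be any
  non-empty finite subset of `Γ ∩ (0, T)` (§3.3: `Γ'` need not consist of the first `n` zeros).
* `limsup ≥ S` / `liminf ≤ −S` are phrased filter-wise as in `RHWave0.lean` and
  `BestTrudgian2015_thm1`: `∀ a < S, ∃ᶠ x, a√x < M(x)` and `∀ a > −S, ∃ᶠ x, M(x) < a√x`.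
* Nothing here is specific to the constant: `frequently_gt_and_lt_of_nIndependent` gives the
  bound for any certified `{N_γ}`-independent configuration, e.g. a future smaller in-tree
  certificate via `Literature.NumberTheory.LFunctions.BestTrudgian.nIndependent_of_gramSchmidt_bounds`.

## References

* [BestTrudgian2015] §1 Theorem 1; §2 (2.1)–(2.3), Definition 1, Theorem 2, §2.1 (2.7)–(2.9);
  §3.2 (kernel `f₀`), §3.3 (ordering `≺`), §3.4 Theorem 4 (read from arXiv:1209.3843).
* [Ingham1942] A. E. Ingham, *On two conjectures in the theory of numbers*, Amer. J. Math. 64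
  (1942) 313–319 ((2.7); cited through [BestTrudgian2015] and [OdlyzkoTeRiele1985, §2 p. 141]).
* R. J. Anderson, H. M. Stark, *Oscillation theorems*, LNM 899 (1981) 79–106 (Theorem 2; cited
  through [BestTrudgian2015]).
* [OdlyzkoTeRiele1985] §2 p. 141 (one-sided bounds give RH and simple zeros), §4.1 (4.1) (the
  kernel).
-/

noncomputable section

open Complex Filter Topology
open Literature.NumberTheory.LFunctions

namespace Literature.Barriers.RiemannHypothesis

/-! ## (2.7): the alternative of Ingham — proved -/

/-- A one-sided bound `η M(x) ≤ A √x` (`x ≥ x₁`, `η = ±1`) implies the Riemann hypothesis and the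
simplicity of all non-trivial zeros (Odlyzko–te Riele §2, p. 141, after Ingham [1942]; the tree's
`zetaZeros_simple_onLine_of_oneSided`, restated for Mathlib's `RiemannHypothesis` and the tree's
`SimpleZerosConjecture` via `mem_riemannZetaNontrivialZeros_iff_holds`).
[cite: OdlyzkoTeRiele1985, §2 p. 141 (i)–(ii)] [cite: BestTrudgian2015, §2.1 (2.7)] -/
theorem riemannHypothesis_and_simple_of_oneSided {η A x₁ : ℝ} (hη : η = 1 ∨ η = -1)
    (hb : ∀ x, x₁ ≤ x → η * (mertensFunction x : ℝ) ≤ A * Real.sqrt x) :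
    RiemannHypothesis ∧ SimpleZerosConjecture := by
  have hz := zetaZeros_simple_onLine_of_oneSided hη hb
  constructor
  · intro s hs hnt _
    have hmem : s ∈ ZetaZeros.riemannZetaNontrivialZeros :=
      ⟨hs, by rintro ⟨n, hn⟩; exact hnt ⟨n, hn.symm⟩⟩
    obtain ⟨-, h0, h1⟩ := mem_riemannZetaNontrivialZeros_iff_holds.1 hmem
    exact (hz s hs h0 h1).1
  · intro ρ hρ
    obtain ⟨hζ, h0, h1⟩ := mem_riemannZetaNontrivialZeros_iff_holds.1 hρ
    exact (hz ρ hζ h0 h1).2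

/-- **Best–Trudgian (2.7) (Ingham 1942), proved:** "`liminf_{x→∞} M(x)/√x = −∞`,
`limsup_{x→∞} M(x)/√x = ∞` follows if either the Riemann hypothesis is false or not all the zeroes
are simple" — filter-wise: for every `C`, `M(x) > C√x` for arbitrarily large `x`, and
`M(x) < −C√x` for arbitrarily large `x`. (Contrapositive of the previous theorem: the failure of
either conclusion is a one-sided bound.) [cite: BestTrudgian2015, §2.1 (2.7)] [cite: Ingham1942] -/
theorem frequently_gt_and_lt_of_not_riemannHypothesis_or_not_simple
    (h : ¬ RiemannHypothesis ∨ ¬ SimpleZerosConjecture) :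
    (∀ C : ℝ, ∃ᶠ x : ℝ in atTop, C * Real.sqrt x < mertensFunction x) ∧
    (∀ C : ℝ, ∃ᶠ x : ℝ in atTop, (mertensFunction x : ℝ) < -(C * Real.sqrt x)) := by
  have key : ∀ {η A x₁ : ℝ}, (η = 1 ∨ η = -1) →
      (∀ x, x₁ ≤ x → η * (mertensFunction x : ℝ) ≤ A * Real.sqrt x) → False := by
    intro η A x₁ hη hb
    obtain ⟨hRH, hS⟩ := riemannHypothesis_and_simple_of_oneSided hη hb
    exact h.elim (fun h ↦ h hRH) (fun h ↦ h hS)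
  constructor
  · intro C
    by_contra hC
    obtain ⟨x₁, hx₁⟩ := Filter.eventually_atTop.1 (Filter.not_frequently.1 hC)
    exact key (A := C) (Or.inl rfl) fun x hx ↦ by rw [one_mul]; exact not_lt.mp (hx₁ x hx)
  · intro C
    by_contra hC
    obtain ⟨x₁, hx₁⟩ := Filter.eventually_atTop.1 (Filter.not_frequently.1 hC)
    exact key (A := C) (Or.inr rfl) fun x hx ↦ by linarith [not_lt.mp (hx₁ x hx)]

/-! ## Theorem 2 for `M` with the kernel of §3.2 — named fact (discharged in `BestTrudgian2015Proofs.lean`) -/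

/-- The weight of an ordinate `γ` at height `T` in (2.8)–(2.9) with the kernel of §3.2:
`f₀(γ)/|ρ ζ'(ρ)|`, `ρ = ½ + iγ`, `f₀(t) = (1 − |t|/T)cos(πt/T) + π⁻¹ sin(π|t|/T)` (`|t| ≤ T`), i.e.
`g(γ/T)` for the Jurkat–Peyerimhoff weight `g = jurkatPeyerimhoffKernel` of the tree. (At a zero
of `ζ'` the value is the junk `·/0 = 0`; the facts below use it under the simplicity hypothesis or
for zeros known to be simple.) [cite: BestTrudgian2015, §2.1 (2.8)–(2.9) and §3.2] -/
def BestTrudgian2015.weight (T γ : ℝ) : ℝ :=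
  jurkatPeyerimhoffKernel (γ / T) / ‖(1 / 2 + γ * I) * deriv riemannZeta (1 / 2 + γ * I)‖

/-- NAMED FACT — **Best–Trudgian 2015, Theorem 2 (Anderson–Stark) for `g = M`, with the kernel of
§3.2**, i.e. (2.8)–(2.9) as used in the proof of Theorem 1: *assume the Riemann hypothesis and the
simplicity of the zeroes (§2.1). Let `T > 0` be not an ordinate (`T = γ_{L+1} − ε`), `Γ` the set of
positive ordinates of the zeros, `Γ' = {γ₁, …, γ_M}` (`M ≥ 1`) a set of ordinates in `(0, T)` and
`N_γ ≥ 1` integers. If the elements of `Γ'` are `{N_γ}`-independent in `Γ ∩ [0, T]`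
(Definition 1), then `limsup_{x→∞} M(x)/x^{1/2} ≥ Σ_{γ ∈ Γ'} (2N_γ/(N_γ+1)) f₀(γ)/|ρζ'(ρ)|` and
`liminf_{x→∞} M(x)/x^{1/2} ≤ −Σ_{γ ∈ Γ'} (2N_γ/(N_γ+1)) f₀(γ)/|ρζ'(ρ)|`* (printed in (2.8)–(2.9)
with Fejér's `1 − γ/T`; §3.2: "A permissible function for such an endeavour is one which has a
non-negative Fourier transform and is supported on `[−T, T]` … We use the function `f₀` … which
is used by Odlyzko and te Riele"). Both conclusions filter-wise. Users take
`(h : BestTrudgian2015_thm2M)`. [cite: BestTrudgian2015, Theorem 2 with §2.1 (2.8)–(2.9) and §3.2] -/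
def BestTrudgian2015_thm2M : Prop :=
  RiemannHypothesis → SimpleZerosConjecture →
    ∀ (T : ℝ) (Γ' : Finset ℝ) (N : ℝ → ℕ), 0 < T → T ∉ zetaPositiveOrdinates →
      Γ'.Nonempty → (↑Γ' ⊆ zetaPositiveOrdinates ∩ Set.Ioo 0 T) → (∀ γ ∈ Γ', 0 < N γ) →
      BestTrudgian.NIndependent zetaPositiveOrdinates T Γ' N →
      (∀ a : ℝ, a < ∑ γ ∈ Γ', 2 * (N γ : ℝ) / (N γ + 1) * BestTrudgian2015.weight T γ →
          ∃ᶠ x : ℝ in atTop, a * Real.sqrt x < mertensFunction x) ∧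
      (∀ a : ℝ, -(∑ γ ∈ Γ', 2 * (N γ : ℝ) / (N γ + 1) * BestTrudgian2015.weight T γ) < a →
          ∃ᶠ x : ℝ in atTop, (mertensFunction x : ℝ) < a * Real.sqrt x)

/-! ## Theorem 1 assembled -/

/-- **The Grosswald–Anderson–Stark route, for any certified configuration:** under
`BestTrudgian2015_thm2M`, a non-empty finite set `Γ'` of ordinates below a non-ordinate height `T`,
`{N}`-independent in `Γ ∩ [0, T]`, gives `limsup M(x)x^{-1/2} ≥ S` and `liminf ≤ −S`,
`S = Σ_{γ ∈ Γ'} (2N/(N+1)) f₀(γ)/|ρζ'(ρ)|`, *unconditionally* — if RH or simplicity fails, (2.7)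
gives more. [cite: BestTrudgian2015, §2.1 (2.7)–(2.9)] -/
theorem frequently_gt_and_lt_of_nIndependent (h2 : BestTrudgian2015_thm2M) {T : ℝ} {Γ' : Finset ℝ}
    {N : ℕ} (hT : 0 < T) (hTΓ : T ∉ zetaPositiveOrdinates) (hne : Γ'.Nonempty)
    (hΓ' : ↑Γ' ⊆ zetaPositiveOrdinates ∩ Set.Ioo 0 T) (hN : 0 < N)
    (hind : BestTrudgian.NIndependent zetaPositiveOrdinates T Γ' (fun _ ↦ N)) :
    (∀ a : ℝ, a < ∑ γ ∈ Γ', 2 * (N : ℝ) / (N + 1) * BestTrudgian2015.weight T γ →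
        ∃ᶠ x : ℝ in atTop, a * Real.sqrt x < mertensFunction x) ∧
    (∀ a : ℝ, -(∑ γ ∈ Γ', 2 * (N : ℝ) / (N + 1) * BestTrudgian2015.weight T γ) < a →
        ∃ᶠ x : ℝ in atTop, (mertensFunction x : ℝ) < a * Real.sqrt x) := by
  by_cases hRS : RiemannHypothesis ∧ SimpleZerosConjecture
  · exact h2 hRS.1 hRS.2 T Γ' (fun _ ↦ N) hT hTΓ hne hΓ' (fun _ _ ↦ hN) hind
  · have h := frequently_gt_and_lt_of_not_riemannHypothesis_or_not_simple (not_and_or.mp hRS)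
    refine ⟨fun a _ ↦ h.1 a, fun a _ ↦ (h.2 (-a)).mono fun x hx ↦ ?_⟩
    rwa [neg_mul, neg_neg] at hx

/-- **Best–Trudgian 2015, Theorem 1, assembled from its printed inputs:** Theorem 2 for `M` with
the kernel of §3.2 (`BestTrudgian2015_thm2M`) and the data of Theorem 4 with the evaluated sum —
a height `T > 0` that is not an ordinate, a finite set `Γ'` of ordinates in `(0, T)`, an integer
`N ≥ 1` such that `Γ'` is `{N}`-independent in `Γ ∩ [0, T]`, and
`Σ_{γ ∈ Γ'} (2N/(N+1)) f₀(γ)/|ρζ'(ρ)| ≥ 1.6383` (which forces `Γ' ≠ ∅`), all explicit hypotheses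
(§3.4, Theorem 4: "Let `Γ'` be the heaviest 500 zeroes with `T = γ₂₀₀₁ − ε`. Then the elements of
`Γ'` are `{N_γ}`-independent, where all `N_γ`s are `4976`") — give
`limsup_{x→∞} M(x)x^{−1/2} ≥ 1.6383` and `liminf_{x→∞} M(x)x^{−1/2} ≤ −1.6383`
(`BestTrudgian2015_thm1` of `MertensDisproof.lean`); the case "RH false or a multiple zero" is
(2.7), proved above. [cite: BestTrudgian2015, Theorem 1 (proof, §2–§3) and Theorem 4 (§3.4)] -/
theorem BestTrudgian2015_thm1_of_nIndependent (h2 : BestTrudgian2015_thm2M) {T : ℝ}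
    {Γ' : Finset ℝ} {N : ℕ} (hT : 0 < T) (hTΓ : T ∉ zetaPositiveOrdinates)
    (hΓ' : ↑Γ' ⊆ zetaPositiveOrdinates ∩ Set.Ioo 0 T) (hN : 0 < N)
    (hind : BestTrudgian.NIndependent zetaPositiveOrdinates T Γ' (fun _ ↦ N))
    (hsum : (1.6383 : ℝ) ≤ ∑ γ ∈ Γ', 2 * (N : ℝ) / (N + 1) * BestTrudgian2015.weight T γ) :
    BestTrudgian2015_thm1 := by
  have hne : Γ'.Nonempty := by
    by_contra h
    rw [Finset.not_nonempty_iff_eq_empty] at h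
    rw [h, Finset.sum_empty] at hsum
    norm_num at hsum
  obtain ⟨hsup, hinf⟩ := frequently_gt_and_lt_of_nIndependent h2 hT hTΓ hne hΓ' hN hind
  intro a ha
  refine ⟨hsup a (by linarith), ((hinf (-a) (by linarith)).mono fun x hx ↦ ?_)⟩
  rwa [neg_mul] at hx

/-- Theorem 1 sharpens Odlyzko–te Riele's `limsup M(x)x^{-1/2} > 1.06` (the tree's `rh.S22`
statement `odlyzko_te_riele_limsup`): take `a = 3/2`. [cite: BestTrudgian2015, Theorem 1] -/
theorem odlyzko_te_riele_limsup_of_BestTrudgian (h : BestTrudgian2015_thm1) :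
    odlyzko_te_riele_limsup :=
  ⟨3 / 2, by norm_num, (h (3 / 2) (by norm_num)).1⟩

/-- … and `liminf M(x)x^{-1/2} < −1.009` (`odlyzko_te_riele_liminf`). [cite: BestTrudgian2015, Theorem 1] -/
theorem odlyzko_te_riele_liminf_of_BestTrudgian (h : BestTrudgian2015_thm1) :
    odlyzko_te_riele_liminf := by
  refine ⟨-(3 / 2), by norm_num, ((h (3 / 2) (by norm_num)).2.mono fun x hx ↦ ?_)⟩
  rwa [neg_mul]

end Literature.Barriers.RiemannHypothesis

end
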